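import Summits.HubbardSuperconductivity.HubbardSuperconductivity.Theorems.LevyLogBootstrapBlock2InfDivXXZLevyReduction
import Summits.HubbardSuperconductivity.HubbardSuperconductivity.Theorems.LevyLogBootstrapBlock2InfDivXXZFiniteBochner
import HarnessLib

/-!
# Crux `Block2InfDivXXZ` (stmt-HubbardSuperconductivity-15048, route `LevyLogBootstrap`):
# the crux is EQUIVALENT to the nonnegativity of all Lévy coefficients

Sibling of `…LevyReduction.lean` (which proves `(∀ ν_q ≥ 0) → Block2InfDivXXZ`). Here the
converse: if the crux holds — every fractional Hadamard power `K₂^{∘s}`, `s ∈ (0, 1]`, of the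
2×2-block transverse kernel of every normalised `S^z_tot = 0` sector ground state is positive
semidefinite — then for every even `M ≥ 4`, `Δ ∈ [-1, 0]`, such `ψ` and every nonzero coarse
momentum `q ∈ (ℤ/(M/2))²` the Lévy coefficient `ν_q = Σ_X log k₂(X) Re χ_q(X)` is nonnegative
(`levyCoeff_nonneg_of_Block2InfDivXXZ`), whence the `iff` (`Block2InfDivXXZ_iff_levyCoeff_nonneg`).
So the crux IS the finite family of sign conditions that the route's kill criterion ("one negative
Lévy coefficient refutes") and its numerics (QMC/ED Lévy tables attached to the item) test.

Proof of the converse: positivity of `K₂` (`block2Kernel_pos`); `K₂^{∘t} = exp(-t·(-log K₂))` is a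
positive definite kernel for `t ∈ (0, 1]` (matrix ⇒ kernel on a finite type,
`isPosDefKernel_iff_fintype`); Schoenberg's theorem, direction ⇐, needs the exponentials only for
SMALL `t` (`isNegDefKernel_of_isPosDefKernel_exp_small`: `ψ = lim_{t→0⁺} (1 - exp(-tψ))/t`, BCR
Ch. 3 Thm. 2.2), so `-log K₂` is negative definite on the fine torus; pulling back along the even
section `X ↦ 2X` of the block map and the factorisation `K₂(2X, 2Y) = k₂(X - Y)`
(`block2Kernel_eq_coarse`, `coarse_double`) give negative type of `(X, Y) ↦ -log k₂(X - Y)` on the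
coarse torus, and Bochner on the finite torus (⇒,
`Literature.Probability.LatticeModels.torusFourier_re_nonneg_of_isNegDefKernel_neg_sub`) gives
`ν_q ≥ 0`.

Sources: Berg–Christensen–Ressel (1984) Ch. 3 Thm. 2.2, Ch. 4 §3; Schoenberg (1938); Horn, Trans.
AMS 136 (1969) 269 (infinitely divisible kernels); Rudin (1962) §1.4.3. No definition; sorry-free.
-/

noncomputable section

set_option linter.dupNamespace false

namespace Summit.HubbardSuperconductivity.HubbardSuperconductivity.Theorems.LevyLogBootstrap

open scoped BigOperators Matrix ComplexOrder ComplexConjugate Topology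
open Matrix Finset Complex Filter
open Literature.MathematicalPhysics.QuantumLattice Literature.Probability.LatticeModels
open Literature.Analysis.Matrix

/-- **BCR Thm. 3.2.2, direction ⇐, with small exponents only**: if `exp(-tψ)` is a positive
definite kernel for every `t ∈ (0, 1]`, then `ψ` is negative definite — for such `t` the kernel
`(1 - exp(-tψ))/t` is negative definite and `ψ` is their pointwise limit as `t → 0⁺`
(`isNegDefKernel_of_tendsto`). [cite: BergChristensenRessel1984, Ch. 3 Thm. 2.2 (PDF p. 75)] -/
theorem isNegDefKernel_of_isPosDefKernel_exp_small {X : Type*} {ψ : X → X → ℝ}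
    (h : ∀ t : ℝ, 0 < t → t ≤ 1 → IsPosDefKernel fun x y => Real.exp (-(t * ψ x y))) :
    IsNegDefKernel ψ := by
  refine isNegDefKernel_of_tendsto (l := nhdsWithin (0 : ℝ) (Set.Ioi 0))
    (ψs := fun t x y => (1 - Real.exp (-(t * ψ x y))) / t) ?_
    fun x y => tendsto_one_sub_exp_neg_mul_div (ψ x y)
  filter_upwards [Ioc_mem_nhdsGT (zero_lt_one' ℝ)] with t ht
  have ht0 : 0 < t := ht.1
  obtain ⟨hsymm, hq⟩ := h t ht0 ht.2
  refine ⟨fun x y => ?_, fun n x c hc => ?_⟩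
  · have hs : Real.exp (-(t * ψ x y)) = Real.exp (-(t * ψ y x)) := hsymm x y
    show (1 - Real.exp (-(t * ψ x y))) / t = (1 - Real.exp (-(t * ψ y x))) / t
    rw [hs]
  · have hq' : 0 ≤ ∑ j, ∑ k, c j * c k * Real.exp (-(t * ψ (x j) (x k))) := hq n x c
    show ∑ j, ∑ k, c j * c k * ((1 - Real.exp (-(t * ψ (x j) (x k)))) / t) ≤ 0
    have hcc : ∑ j, ∑ k, c j * c k = 0 := by
      rw [← Finset.sum_mul_sum, hc, mul_zero]
    have e : ∑ j, ∑ k, c j * c k * ((1 - Real.exp (-(t * ψ (x j) (x k)))) / t) =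
        t⁻¹ * (∑ j, ∑ k, c j * c k -
          ∑ j, ∑ k, c j * c k * Real.exp (-(t * ψ (x j) (x k)))) := by
      rw [← Finset.sum_sub_distrib, Finset.mul_sum]
      refine Finset.sum_congr rfl fun j _ => ?_
      rw [← Finset.sum_sub_distrib, Finset.mul_sum]
      exact Finset.sum_congr rfl fun k _ => by ring
    rw [e, hcc, zero_sub]
    exact mul_nonpos_of_nonneg_of_nonpos (inv_nonneg.mpr ht0.le) (neg_nonpos.mpr hq')

/-- Matrix → kernel on a finite type: an entrywise-positive kernel `K` on a `Fintype` all of whose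
Hadamard powers `K^{∘t}`, `t ∈ (0, 1]`, are positive semidefinite MATRICES has `-log K` of negative
type (`isPosDefKernel_iff_fintype` + `isNegDefKernel_of_isPosDefKernel_exp_small`).
[cite: BergChristensenRessel1984, Ch. 3 Thm. 2.2 (PDF p. 75)] -/
theorem isNegDefKernel_negLog_of_posSemidef_rpow {X : Type} [Fintype X] [DecidableEq X]
    (K : X → X → ℝ) (hpos : ∀ x y, 0 < K x y) (hsymm : ∀ x y, K x y = K y x)
    (h : ∀ t : ℝ, 0 < t → t ≤ 1 → (Matrix.of fun x y => K x y ^ t).PosSemidef) :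
    IsNegDefKernel fun x y => -Real.log (K x y) := by
  refine isNegDefKernel_of_isPosDefKernel_exp_small fun t ht ht1 => ?_
  have heq : (fun x y => Real.exp (-(t * -Real.log (K x y)))) = fun x y => K x y ^ t := by
    funext x y
    rw [Real.rpow_def_of_pos (hpos x y)]
    congr 1
    ring
  rw [heq, isPosDefKernel_iff_fintype]
  refine ⟨fun x y => by rw [hsymm x y], fun c => ?_⟩
  have hq := (h t ht ht1).dotProduct_mulVec_nonneg c
  simp only [dotProduct, Matrix.mulVec, Matrix.of_apply, star_trivial, Finset.mul_sum] at hq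
  refine hq.trans_eq (Finset.sum_congr rfl fun a _ => Finset.sum_congr rfl fun b _ => ?_)
  ring

/-- **The crux forces nonnegative Lévy coefficients** (converse of
`Block2InfDivXXZ_of_levyCoeff_nonneg`): if `Block2InfDivXXZ` holds then for every even `M ≥ 4`,
`Δ ∈ [-1, 0]`, every normalised `S^z_tot = 0` sector ground state `ψ` of `H_M(Δ)` and every nonzero
coarse momentum `q`, `0 ≤ ν_q = Σ_X log k₂(X) Re χ_q(X)`. Equivalently: ONE negative Lévy
coefficient at one `(M, Δ)` refutes the crux (soundness of the route's kill criterion).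
Schoenberg ⇐ (small exponents) + section `X ↦ 2X` of the block map + factorisation
`K₂(2X, 2Y) = k₂(X - Y)` + Bochner on the finite torus. [folklore] -/
theorem levyCoeff_nonneg_of_Block2InfDivXXZ
    (h : Summit.HubbardSuperconductivity.HubbardSuperconductivity.Theses.LevyLogBootstrap.Block2InfDivXXZ) :
    ∀ (M : ℕ) [NeZero M] [NeZero (M / 2)], Even M → 4 ≤ M → ∀ Δ ∈ Set.Icc (-1:ℝ) 0,
      ∀ (ψ : TensorIndex (TorusSite 2 M) 2 → ℂ),
      ψ ∈ @spinZSector (TorusSite 2 M) _ _ 1 0 → star ψ ⬝ᵥ ψ = 1 →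
      Matrix.mulVec (xxzHamiltonian 1 (torusGraph 2 M) (-1) Δ) ψ =
        ((lowestEnergyInSector 1 (xxzHamiltonian 1 (torusGraph 2 M) (-1) Δ) 0 : ℝ) : ℂ) • ψ →
      ∀ q : TorusSite 2 (M / 2), q ≠ 0 →
        0 ≤ ∑ X : TorusSite 2 (M / 2), Real.log (∑ x' : TorusSite 2 M, ∑ y' : TorusSite 2 M,
              if (∀ i : Fin 2, (x' i).val / 2 = (X i).val) ∧ (∀ i : Fin 2, (y' i).val / 2 = 0) then
                (star ψ ⬝ᵥ Matrix.mulVec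
                  (onSite x' (spinRaise 1) * onSite y' (spinLower 1)) ψ).re
              else 0) * (torusChar q X).re := by
  intro M _ _ hEven h4 Δ hΔ ψ hψ hnorm heig q hq
  classical
  have hM : M = 2 * (M / 2) := (Nat.two_mul_div_two_of_even hEven).symm
  -- the fine block kernel `K₂` and the coarse kernel `k₂`
  set K₂ : TorusSite 2 M → TorusSite 2 M → ℝ := fun x y => ∑ x' : TorusSite 2 M, ∑ y' : TorusSite 2 M,
      if (∀ i : Fin 2, (x' i).val / 2 = (x i).val / 2) ∧ (∀ i : Fin 2, (y' i).val / 2 = (y i).val / 2)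
      then (star ψ ⬝ᵥ Matrix.mulVec (onSite x' (spinRaise 1) * onSite y' (spinLower 1)) ψ).re
      else 0 with hK₂
  set k₂ : TorusSite 2 (M / 2) → ℝ := fun X => ∑ x' : TorusSite 2 M, ∑ y' : TorusSite 2 M,
      if (∀ i : Fin 2, (x' i).val / 2 = (X i).val) ∧ (∀ i : Fin 2, (y' i).val / 2 = 0) then
        (star ψ ⬝ᵥ Matrix.mulVec (onSite x' (spinRaise 1) * onSite y' (spinLower 1)) ψ).re
      else 0 with hk₂
  set β : TorusSite 2 M → TorusSite 2 (M / 2) := fun z i => (((z i).val / 2 : ℕ) : ZMod (M / 2))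
    with hβ
  set ι : TorusSite 2 (M / 2) → TorusSite 2 M := fun V j => ((2 * (V j).val : ℕ) : ZMod M) with hι
  -- (1) `-log K₂` is negative definite on the fine torus
  have hpos : ∀ x y, 0 < K₂ x y := fun x y => block2Kernel_pos M hEven h4 Δ hΔ ψ hψ hnorm heig x y
  have hsymm : ∀ x y, K₂ x y = K₂ y x := fun x y => by
    simp only [hK₂]
    rw [Finset.sum_comm]
    refine Finset.sum_congr rfl fun a _ => Finset.sum_congr rfl fun b _ => ?_
    rw [if_congr and_comm (re_expect_raiseLower_symm 1 ψ b a) rfl]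
  have hneg : IsNegDefKernel fun x y => -Real.log (K₂ x y) :=
    isNegDefKernel_negLog_of_posSemidef_rpow K₂ hpos hsymm fun t ht ht1 =>
      h M hEven h4 Δ hΔ ψ hψ hnorm heig t ht ht1
  -- (2) factorisation through the coarse torus and the section `ι`
  have hfac : ∀ x y, K₂ x y = k₂ (β x - β y) := fun x y => by
    simp only [hK₂, hk₂, hβ]
    exact block2Kernel_eq_coarse M hM hEven Δ ψ hψ hnorm heig x y
  have hβι : ∀ V, β (ι V) = V := fun V => coarse_double hM V
  have hcoarse : IsNegDefKernel fun X Y : TorusSite 2 (M / 2) => -Real.log (k₂ (X - Y)) := by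
    have hc := hneg.comp_fun ι
    refine ⟨fun X Y => ?_, fun n x c hc' => ?_⟩
    · have := hc.1 X Y
      simp only [hfac, hβι] at this
      exact this
    · have := hc.2 n x c hc'
      simp only [hfac, hβι] at this
      exact this
  -- (3) Bochner on the finite torus, direction ⇒
  exact torusFourier_re_nonneg_of_isNegDefKernel_neg_sub (fun X => Real.log (k₂ X)) hcoarse q hq

/-- **`Block2InfDivXXZ` ⇔ all Lévy coefficients are nonnegative.** The crux of route
`LevyLogBootstrap` (infinite divisibility of the 2×2-block transverse kernel of every `S^z_tot = 0`
sector ground state, even `M ≥ 4`, `Δ ∈ [-1, 0]`) is equivalent to the finite family of sign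
conditions `ν_q(M, Δ, ψ) ≥ 0`, `q ≠ 0` in `(ℤ/(M/2))²`, on the coarse block kernel
(`Block2InfDivXXZ_of_levyCoeff_nonneg` and `levyCoeff_nonneg_of_Block2InfDivXXZ`). Schoenberg
(1938); Berg–Christensen–Ressel (1984) Ch. 3 Thm. 2.2, Ch. 4 §3; Horn (1969). [folklore] -/
theorem Block2InfDivXXZ_iff_levyCoeff_nonneg :
    Summit.HubbardSuperconductivity.HubbardSuperconductivity.Theses.LevyLogBootstrap.Block2InfDivXXZ ↔
    ∀ (M : ℕ) [NeZero M] [NeZero (M / 2)], Even M → 4 ≤ M → ∀ Δ ∈ Set.Icc (-1:ℝ) 0,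
      ∀ (ψ : TensorIndex (TorusSite 2 M) 2 → ℂ),
      ψ ∈ @spinZSector (TorusSite 2 M) _ _ 1 0 → star ψ ⬝ᵥ ψ = 1 →
      Matrix.mulVec (xxzHamiltonian 1 (torusGraph 2 M) (-1) Δ) ψ =
        ((lowestEnergyInSector 1 (xxzHamiltonian 1 (torusGraph 2 M) (-1) Δ) 0 : ℝ) : ℂ) • ψ →
      ∀ q : TorusSite 2 (M / 2), q ≠ 0 →
        0 ≤ ∑ X : TorusSite 2 (M / 2), Real.log (∑ x' : TorusSite 2 M, ∑ y' : TorusSite 2 M,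
              if (∀ i : Fin 2, (x' i).val / 2 = (X i).val) ∧ (∀ i : Fin 2, (y' i).val / 2 = 0) then
                (star ψ ⬝ᵥ Matrix.mulVec
                  (onSite x' (spinRaise 1) * onSite y' (spinLower 1)) ψ).re
              else 0) * (torusChar q X).re :=
  ⟨fun h M _ _ hE h4 Δ hΔ ψ hψ hn he q hq =>
      levyCoeff_nonneg_of_Block2InfDivXXZ h M hE h4 Δ hΔ ψ hψ hn he q hq,
    fun h => Block2InfDivXXZ_of_levyCoeff_nonneg h⟩

/-- **Per-instance equivalence** (the form a finite-size certificate checks, e.g. the exact-rational /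
interval certificate for `M = 4`, all `Δ ∈ [-1, 0]`, attached to the item). For ONE admissible instance — even `M ≥ 4`, `Δ ∈ [-1, 0]`, a
normalised `S^z_tot = 0` sector ground state `ψ` of `H_M(Δ)` — the 2×2-block kernel `K₂(ψ)` is
infinitely divisible (every fractional Hadamard power `K₂^{∘s}`, `s ∈ (0, 1]`, positive
semidefinite) iff every Lévy coefficient `ν_q(ψ) = Σ_X log k₂(X) Re χ_q(X)`, `q ≠ 0` in
`(ℤ/(M/2))²`, is nonnegative. `⇐` is `stub_blockLogNegType_of_levyCoeff` + Schoenberg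
(`posSemidef_rpow_of_negLogType`, positivity `block2Kernel_pos`); `⇒`: Schoenberg ⇐ with small
exponents, the even section `X ↦ 2X` of the block map, the factorisation `K₂(2X, 2Y) = k₂(X - Y)`
and Bochner on the finite torus. This is the statement a per-size certificate (e.g. the exact
`M = 4` check over `Δ ∈ [-1, 0]` attached to the item) verifies. [folklore] -/
theorem block2_rpow_posSemidef_iff_levyCoeff_nonneg :
    ∀ (M : ℕ) [NeZero M] [NeZero (M / 2)], Even M → 4 ≤ M → ∀ (Δ : ℝ), Δ ∈ Set.Icc (-1:ℝ) 0 →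
    ∀ (ψ : TensorIndex (TorusSite 2 M) 2 → ℂ), ψ ∈ @spinZSector (TorusSite 2 M) _ _ 1 0 →
    star ψ ⬝ᵥ ψ = 1 →
    Matrix.mulVec (xxzHamiltonian 1 (torusGraph 2 M) (-1) Δ) ψ =
      ((lowestEnergyInSector 1 (xxzHamiltonian 1 (torusGraph 2 M) (-1) Δ) 0 : ℝ) : ℂ) • ψ →
    ((∀ s : ℝ, 0 < s → s ≤ 1 →
      (Matrix.of fun (x y : TorusSite 2 M) => (∑ x' : TorusSite 2 M, ∑ y' : TorusSite 2 M,
        if (∀ i : Fin 2, (x' i).val / 2 = (x i).val / 2) ∧ (∀ i : Fin 2, (y' i).val / 2 = (y i).val / 2)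
        then (star ψ ⬝ᵥ Matrix.mulVec (onSite x' (spinRaise 1) * onSite y' (spinLower 1)) ψ).re
        else 0) ^ s).PosSemidef) ↔
    (∀ q : TorusSite 2 (M / 2), q ≠ 0 →
      0 ≤ ∑ X : TorusSite 2 (M / 2), Real.log (∑ x' : TorusSite 2 M, ∑ y' : TorusSite 2 M,
            if (∀ i : Fin 2, (x' i).val / 2 = (X i).val) ∧ (∀ i : Fin 2, (y' i).val / 2 = 0) then
              (star ψ ⬝ᵥ Matrix.mulVec
                (onSite x' (spinRaise 1) * onSite y' (spinLower 1)) ψ).re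
            else 0) * (torusChar q X).re)) := by
  intro M _ _ hEven h4 Δ hΔ ψ hψ hnorm heig
  classical
  have hM : M = 2 * (M / 2) := (Nat.two_mul_div_two_of_even hEven).symm
  -- the fine block kernel `K₂` and the coarse kernel `k₂`
  set K₂ : TorusSite 2 M → TorusSite 2 M → ℝ := fun x y => ∑ x' : TorusSite 2 M, ∑ y' : TorusSite 2 M,
      if (∀ i : Fin 2, (x' i).val / 2 = (x i).val / 2) ∧ (∀ i : Fin 2, (y' i).val / 2 = (y i).val / 2)
      then (star ψ ⬝ᵥ Matrix.mulVec (onSite x' (spinRaise 1) * onSite y' (spinLower 1)) ψ).re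
      else 0 with hK₂
  set k₂ : TorusSite 2 (M / 2) → ℝ := fun X => ∑ x' : TorusSite 2 M, ∑ y' : TorusSite 2 M,
      if (∀ i : Fin 2, (x' i).val / 2 = (X i).val) ∧ (∀ i : Fin 2, (y' i).val / 2 = 0) then
        (star ψ ⬝ᵥ Matrix.mulVec (onSite x' (spinRaise 1) * onSite y' (spinLower 1)) ψ).re
      else 0 with hk₂
  have hpos : ∀ x y, 0 < K₂ x y := fun x y => block2Kernel_pos M hEven h4 Δ hΔ ψ hψ hnorm heig x y
  refine ⟨fun h q hq => ?_, fun hν s hs _hs1 => ?_⟩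
  · set β : TorusSite 2 M → TorusSite 2 (M / 2) := fun z i => (((z i).val / 2 : ℕ) : ZMod (M / 2))
      with hβ
    set ι : TorusSite 2 (M / 2) → TorusSite 2 M := fun V j => ((2 * (V j).val : ℕ) : ZMod M) with hι
    -- (1) `-log K₂` is negative definite on the fine torus
    have hsymm : ∀ x y, K₂ x y = K₂ y x := fun x y => by
      simp only [hK₂]
      rw [Finset.sum_comm]
      refine Finset.sum_congr rfl fun a _ => Finset.sum_congr rfl fun b _ => ?_
      rw [if_congr and_comm (re_expect_raiseLower_symm 1 ψ b a) rfl]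
    have hneg : IsNegDefKernel fun x y => -Real.log (K₂ x y) :=
      isNegDefKernel_negLog_of_posSemidef_rpow K₂ hpos hsymm fun t ht ht1 => h t ht ht1
    -- (2) factorisation through the coarse torus and the section `ι`
    have hfac : ∀ x y, K₂ x y = k₂ (β x - β y) := fun x y => by
      simp only [hK₂, hk₂, hβ]
      exact block2Kernel_eq_coarse M hM hEven Δ ψ hψ hnorm heig x y
    have hβι : ∀ V, β (ι V) = V := fun V => coarse_double hM V
    have hcoarse : IsNegDefKernel fun X Y : TorusSite 2 (M / 2) => -Real.log (k₂ (X - Y)) := by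
      have hc := hneg.comp_fun ι
      refine ⟨fun X Y => ?_, fun n x c hc' => ?_⟩
      · have := hc.1 X Y
        simp only [hfac, hβι] at this
        exact this
      · have := hc.2 n x c hc'
        simp only [hfac, hβι] at this
        exact this
    -- (3) Bochner on the finite torus, direction ⇒
    exact torusFourier_re_nonneg_of_isNegDefKernel_neg_sub (fun X => Real.log (k₂ X)) hcoarse q hq
  · exact posSemidef_rpow_of_negLogType _ hpos
      (stub_blockLogNegType_of_levyCoeff M hEven Δ ψ hψ hnorm heig hν) s hs

end Summit.HubbardSuperconductivity.HubbardSuperconductivity.Theorems.LevyLogBootstrap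

end
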